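import Literature.NumberTheory.EllipticCurves.TwoMultiplicativePrimesDensity
import HarnessLib

/-!
# Bhargava–Skinner–Zhang, Lemma 20, second property, WITH the printed side condition `ℓ ≠ p`:
# almost every `E_{A,B}` has two primes `ℓ₁ ≠ ℓ₂` of multiplicative reduction, BOTH DIFFERENT FROM
# (indeed larger than) any prescribed `p`, with `ord_{ℓᵢ}(4A³ + 27B²) = 1`

Source: M. Bhargava, C. Skinner, W. Zhang, *A majority of elliptic curves over `ℚ` satisfy the
Birch and Swinnerton-Dyer conjecture*, arXiv:1407.1826 (2014), Lemma 20 (held text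
`paper:arxiv-1407.1826`, chunk `p0010` L20–L25):

> "Let `p` be any prime. Then, when ordered by height, a density of 100% of elliptic curves `E`
> over `ℚ` possess the following two properties: • `E[p]` is an irreducible `Gal(ℚ̄/ℚ)`-module;
> • There exist at least two prime factors `ℓ ∥ N(E)`, **`ℓ ≠ p`**, such that `E[p]` is ramified
> at `ℓ`."

and its printed proof (`p0010` L33–L48): "`S(L) := ⋃_{5 ≤ ℓ ≤ L, ℓ ≠ p} S(L, ℓ)` … any curve in
the complement of `S(L)` satisfies the second property of the lemma with two primes
`5 ≤ ℓ₁, ℓ₂ ≤ L`" (with `ℓᵢ ≠ p` by the definition of `S(L)`).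

The tree's `TwoMultiplicativePrimesDensity.lean` PROVES the second property in the `p`-UNIFORM
form "two distinct primes `ℓ₁, ℓ₂ ≥ 5` with `ℓᵢ ∤ A`, `ord_{ℓᵢ}(4A³ + 27B²) = 1`"
(`TwoMultPrimes.heightDensityGE_twoOrdOnePrimes`), which gives Lemma 20's two primes `ℓ ≠ p` for
every `p ∉ {ℓ₁, ℓ₂}` — but NOT for `p = 5` when one of the two primes supplied IS `5` (possible on
the curves multiplicative at `5` with `ord₅(4A³ + 27B²) = 1`, a set of positive density). The
consumers at `p = 5` — the binder `hram₂` of `bsz_h9_five_of_zhang_of_skinnerZhang`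
(`LeadingTermBSZRankOneH9Proofs.lean`: "`∃ ℓ₁ ℓ₂`, `ℓ₁ ≠ ℓ₂ ∧ 5 < ℓ₁ ∧ 5 < ℓ₂ ∧` multiplicative at
both `∧ ¬ 5 ∣ ord_{ℓᵢ}(4A³ + 27B²)`", feeding W. Zhang's hypothesis (3) via
`zhang_hyp3_of_two_ramified` and Skinner–Zhang's (c)) and `hram` of
`bsz_h5_multiplicative_five_of_thmA` ("`∃ ℓ`, `5 < ℓ ∧` multiplicative `∧ ¬ 5 ∣ ord_ℓ`") — need the
printed `ℓ ≠ p` form. THIS FILE proves it, by re-running the tree's sieve with the primes `q < m`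
removed from the sieving set for an arbitrary threshold `m` (the divergence of `Σ_q δ_q` over the
primes `q ≥ max(5, m)` is all that is used; `δ_q ≥ (16/25)/q` and `Σ_p 1/p = ∞`).

Contents (THEOREMS ONLY — 0 definitions, 0 named facts):
* `TwoMultPrimes.exists_primes_sumDensity_ge_ge` — for every `m` and `c` a finite set of primes
  `q ≥ max(5, m)` with `Σ δ_q ≥ c` (generalises `exists_primes_sumDensity_ge`, `m = 0`).
* `TwoMultPrimes.heightDensityGE_twoOrdOnePrimes_ge` — for every `m`: density one of `(A, B)` with
  two distinct primes `ℓᵢ ≥ max(5, m)`, `ℓᵢ ∤ A`, `ord_{ℓᵢ}(4A³ + 27B²) = 1` (the source's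
  `p`-EXCLUDING form for `m = p + 1`).
* `heightDensityGE_twoMultiplicativePrimes_gt` — for every `m`: density one of `(A, B)` with two
  distinct primes `ℓᵢ > m`, `ℓᵢ ≥ 5` (not merely `≠ m`) at which `E_{A,B}` has multiplicative
  reduction and
  `ord_{ℓᵢ}(4A³ + 27B²) = 1`, in the `∃ _ : Fact ℓᵢ.Prime` spelling of the consumers.
* `heightDensityGE_hram₂_five` — the case `m = 5`: LITERALLY the binder `hram₂` of
  `bsz_h9_five_of_zhang_of_skinnerZhang` (with `¬ 5 ∣ ord` from `ord = 1`) holds for a density-one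
  set of `(A, B)` — the `W`-clause "two ramified primes `ℓ ∥ N`, `ℓ ≠ 5`" of the BSD-DENSITY
  SPRINT's piece `W` (cell book `cells/density/C0-SPEC.md` §1 row `W`, §2 row `hW`);
  `heightDensityGE_hram_five` — one such prime: LITERALLY the binder `hram` of
  `bsz_h5_multiplicative_five_of_thmA` (rank-`0` multiplicative leg), density one.

Locators for the two further items of the paper this file's docstrings invoke (held text
`paper:arxiv-1407.1826`, page-verified 2026-08-24): **Theorem 5 (c)** = `p0005` L16 («(c) there is at
least one prime `ℓ ≠ p` such that `ℓ ∥ N` and `E[p]` is ramified at `ℓ`») — the hypothesis the binder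
`hram` feeds; **Remark 7** = `p0005` L33–L36 («Suppose `ℓ ∥ N` and `ℓ ≠ p`. The condition that `E[p]`
be ramified at `ℓ` is equivalent to `p ∤ ord_ℓ(Δ_ℓ)` for a minimal discriminant `Δ_ℓ` of `E` at `ℓ`
… for `ℓ ≥ 5`, a Weierstrass equation `E_{A,B}` … is minimal at `ℓ`») — why `ord_{ℓᵢ}(4A³ + 27B²) = 1`
(hence `¬ 5 ∣ ord`) is the ramification clause in the `hram` / `hram₂` currencies below.

[cite: BhargavaSkinnerZhang2014, Lemma 20 (p0010 L20–L25) and its proof (p0010 L33–L48); Thm. 5 (c) (p0005 L16); Remark 7 (p0005 L33–L36)]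
-/

noncomputable section

open scoped Classical

open Filter Topology WeierstrassCurve

namespace Literature.NumberTheory.EllipticCurves

namespace TwoMultPrimes

/-- **`Σ_{q ≥ max(5,m)} δ_q` diverges**: for every threshold `m` and every bound `c` there is a
finite set `P` of primes `q` with `5 ≤ q`, `m ≤ q` and `s_P = Σ_{q ∈ P} δ_q ≥ c` (`δ_q ≥ (16/25)/q`,
`localDensity_ge`, and `Σ_p 1/p = ∞` over the primes, Mathlib's `Nat.Primes.not_summable_one_div`,
minus the finitely many primes `< max(5, m)`). The case `m = 0` is the tree's
`exists_primes_sumDensity_ge`; this is the divergence behind the source's "`μ(S(L))` … which tends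
to `0` as `L` tends to `∞`" with the primes `ℓ ≠ p` (here: `ℓ ≥ m`) only.
[cite: BhargavaSkinnerZhang2014, Lemma 20 (proof, p0010 L36–L48: S(L) over ℓ ≠ p, μ(S(L)) → 0)] -/
theorem exists_primes_sumDensity_ge_ge (m : ℕ) (c : ℝ) :
    ∃ P : Finset ℕ, (∀ q ∈ P, q.Prime ∧ 5 ≤ q ∧ m ≤ q) ∧ c ≤ sumDensity P := by
  set M : ℕ := max 5 m with hM
  -- `f p = 1/p` for `p ≥ M`, `0` otherwise, is not summable over the primes
  set f : Nat.Primes → ℝ := fun p ↦ if M ≤ (p : ℕ) then 1 / ((p : ℕ) : ℝ) else 0 with hf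
  set g : Nat.Primes → ℝ := fun p ↦ if M ≤ (p : ℕ) then 0 else 1 / ((p : ℕ) : ℝ) with hg
  have hfg : (fun p : Nat.Primes ↦ (1 / (p : ℕ) : ℝ)) = fun p ↦ f p + g p := by
    funext p; simp only [hf, hg]; split_ifs <;> simp
  have hgs : Summable g := by
    refine summable_of_ne_finset_zero
      (s := (Finset.range M).preimage (fun p : Nat.Primes ↦ (p : ℕ))
        Nat.Primes.coe_nat_injective.injOn) ?_
    intro p hp
    rw [Finset.mem_preimage, Finset.mem_range, not_lt] at hp
    simp [hg, hp]
  have hfs : ¬ Summable f := by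
    intro h
    have := h.add hgs
    rw [← hfg] at this
    exact Nat.Primes.not_summable_one_div this
  have hf0 : ∀ p, 0 ≤ f p := fun p ↦ by simp only [hf]; split_ifs <;> positivity
  -- hence some finite partial sum exceeds `25/16 · c`
  obtain ⟨s, hs⟩ : ∃ s : Finset Nat.Primes, ¬ (∑ p ∈ s, f p ≤ 25 / 16 * c) := by
    by_contra h
    push Not at h
    exact hfs (summable_of_sum_le hf0 h)
  rw [not_le] at hs
  set emb : Nat.Primes ↪ ℕ := ⟨fun p ↦ (p : ℕ), Nat.Primes.coe_nat_injective⟩ with hemb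
  refine ⟨(s.filter (fun p : Nat.Primes ↦ M ≤ (p : ℕ))).map emb, fun q hq ↦ ?_, ?_⟩
  · rw [Finset.mem_map] at hq
    obtain ⟨p, hp, rfl⟩ := hq
    have hMp : M ≤ (p : ℕ) := (Finset.mem_filter.mp hp).2
    exact ⟨p.2, le_trans (le_max_left 5 m) hMp, le_trans (le_max_right 5 m) hMp⟩
  · rw [sumDensity, Finset.sum_map, Finset.sum_filter]
    simp only [hemb, Function.Embedding.coeFn_mk]
    have hle : ∑ p ∈ s, f p ≤
        25 / 16 * ∑ p ∈ s, (if M ≤ (p : ℕ) then localDensity (p : ℕ) else 0) := by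
      rw [Finset.mul_sum]
      refine Finset.sum_le_sum fun p _ ↦ ?_
      simp only [hf]
      split_ifs with hMp
      · have := localDensity_ge (le_trans (le_max_left 5 m) hMp); linarith
      · simp
    linarith

/-- **Bhargava–Skinner–Zhang, Lemma 20, second property, with a prescribed finite set of small
primes excluded** (the printed "`ℓ ≠ p`", here "`ℓ ≥ m`" for any threshold `m`): a (lower)
naive-height density one of pairs `(A, B)` admit two distinct primes `ℓ₁, ℓ₂` with `5 ≤ ℓᵢ`,
`m ≤ ℓᵢ`, `ℓᵢ ∤ A` and `ord_{ℓᵢ}(4A³ + 27B²) = 1` (`LocalHit`). Proof = the tree's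
`heightDensityGE_twoOrdOnePrimes` verbatim with the sieving set supplied by
`exists_primes_sumDensity_ge_ge m` (source, proof of Lemma 20, `p0010` L33–L48:
"`S(L) := ⋃_{5 ≤ ℓ ≤ L, ℓ ≠ p} S(L, ℓ)` … it suffices to show that `μ(S(L))` tends to `0` as `L`
gets large").
[cite: BhargavaSkinnerZhang2014, Lemma 20 (proof, p0010 L33–L48)] -/
theorem heightDensityGE_twoOrdOnePrimes_ge (m : ℕ) :
    HeightDensityGE (fun AB : ℤ × ℤ ↦ ∃ ℓ₁ ℓ₂ : ℕ, ℓ₁.Prime ∧ ℓ₂.Prime ∧ 5 ≤ ℓ₁ ∧ 5 ≤ ℓ₂ ∧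
      m ≤ ℓ₁ ∧ m ≤ ℓ₂ ∧ ℓ₁ ≠ ℓ₂ ∧ LocalHit ℓ₁ AB ∧ LocalHit ℓ₂ AB) 1 := by
  intro ε hε
  -- `(1 + 2s) e^{-s} → 0`
  have hlim : Tendsto (fun s : ℝ ↦ (1 + 2 * s) * Real.exp (-s)) atTop (𝓝 0) := by
    have h0 : Tendsto (fun s : ℝ ↦ Real.exp (-s)) atTop (𝓝 0) :=
      Real.tendsto_exp_neg_atTop_nhds_zero
    have h1 := Real.tendsto_pow_mul_exp_neg_atTop_nhds_zero 1
    have := h0.add (h1.const_mul 2)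
    simp only [pow_one, mul_zero, add_zero] at this
    refine this.congr fun s ↦ ?_
    ring
  obtain ⟨c, hc⟩ :=
    eventually_atTop.mp (hlim.eventually (gt_mem_nhds (show (0 : ℝ) < ε / 4 by positivity)))
  obtain ⟨P, hP, hcP⟩ := exists_primes_sumDensity_ge_ge m c
  have hP' : ∀ q ∈ P, q.Prime ∧ 5 ≤ q := fun q hq ↦ ⟨(hP q hq).1, (hP q hq).2.1⟩
  haveI : NeZero (modulus P) := ⟨modulus_ne_zero fun q hq ↦ (hP q hq).1⟩
  have hbound := (resProp_noHit_atMostOneHit_le P hP').2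
  have hη : ((residues (modulus P) (AtMostOneHit P)).card : ℝ) / ((modulus P : ℕ) : ℝ) ^ 2 ≤
      ε / 4 := by
    rw [← resProp_eq]
    exact hbound.trans (hc _ hcP).le
  have hper : IsPeriodic (modulus P) (AtMostOneHit P) :=
    isPeriodic_atMostOneHit fun q hq ↦ isPeriodic_localHit_modulus (fun q hq ↦ (hP q hq).1) hq
  have hD := heightDensityGE_not_of_periodic hper hη
  -- the complement of "at most one hit" is contained in the target property
  have hmono : ∀ AB, ¬ AtMostOneHit P AB → ∃ ℓ₁ ℓ₂ : ℕ, ℓ₁.Prime ∧ ℓ₂.Prime ∧ 5 ≤ ℓ₁ ∧ 5 ≤ ℓ₂ ∧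
      m ≤ ℓ₁ ∧ m ≤ ℓ₂ ∧ ℓ₁ ≠ ℓ₂ ∧ LocalHit ℓ₁ AB ∧ LocalHit ℓ₂ AB := by
    intro AB h
    simp only [AtMostOneHit, not_forall, exists_prop] at h
    obtain ⟨q₁, hq₁, q₂, hq₂, h₁, h₂, hne⟩ := h
    exact ⟨q₁, q₂, (hP q₁ hq₁).1, (hP q₂ hq₂).1, (hP q₁ hq₁).2.1, (hP q₂ hq₂).2.1, (hP q₁ hq₁).2.2,
      (hP q₂ hq₂).2.2, hne, h₁, h₂⟩
  filter_upwards [hD (ε / 2) (by positivity)] with X hX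
  have hm := heightProportion_mono hmono X
  linarith

end TwoMultPrimes

/-! ## The statement in the currency of the `p = 5` class theorems -/

open TwoMultPrimes in
/-- **Lemma 20, second property, with both primes beyond an arbitrary threshold `m`, in
reduction-type currency.** A (lower) naive-height density one of pairs `(A, B)` admit two distinct
primes `ℓ₁, ℓ₂ > m`, `ℓᵢ ≥ 5` (so `ℓᵢ ≠ p` for every prime `p ≤ m`) at which `E_{A,B}` has
multiplicative reduction (`HasMultiplicativeReductionAtPrime`, from `ℓᵢ ∣ 4A³ + 27B²`, `ℓᵢ ∤ A`,
`ℓᵢ ≥ 5` by the tree's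
`hasMultiplicativeReductionAtPrime_shortWeierstrass_iff_of_isInHeightFamily`) and with
`ord_{ℓᵢ}(4A³ + 27B²) = 1` (so `ℓᵢ ∥ N(E_{A,B})` and `E[p]` is ramified at `ℓᵢ` for every `p`, cf.
Remark 7 of the source).
[cite: BhargavaSkinnerZhang2014, Lemma 20 (second property, ℓ ≠ p; proof p0010 L33–L48), Rem. 7] -/
theorem heightDensityGE_twoMultiplicativePrimes_gt (m : ℕ) :
    HeightDensityGE (fun AB : ℤ × ℤ ↦ ∃ ℓ₁ ℓ₂ : ℕ, ∃ _ : Fact ℓ₁.Prime, ∃ _ : Fact ℓ₂.Prime,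
      ℓ₁ ≠ ℓ₂ ∧ 5 ≤ ℓ₁ ∧ 5 ≤ ℓ₂ ∧ m < ℓ₁ ∧ m < ℓ₂ ∧
      (shortWeierstrass AB).HasMultiplicativeReductionAtPrime ℓ₁ ∧
      (shortWeierstrass AB).HasMultiplicativeReductionAtPrime ℓ₂ ∧
      padicValInt ℓ₁ (4 * AB.1 ^ 3 + 27 * AB.2 ^ 2) = 1 ∧
      padicValInt ℓ₂ (4 * AB.1 ^ 3 + 27 * AB.2 ^ 2) = 1) 1 := by
  have h := (heightDensityGE_twoOrdOnePrimes_ge (m + 1)).and_forall fun AB h ↦ h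
  intro ε hε
  refine (h ε hε).mono fun X hX ↦ hX.trans (heightProportion_mono ?_ X)
  rintro AB ⟨⟨ℓ₁, ℓ₂, hℓ₁, hℓ₂, h5₁, h5₂, hm₁, hm₂, hne, hL₁, hL₂⟩, hAB⟩
  haveI i₁ : Fact ℓ₁.Prime := ⟨hℓ₁⟩
  haveI i₂ : Fact ℓ₂.Prime := ⟨hℓ₂⟩
  have hmult : ∀ {q : ℕ} [Fact q.Prime], 5 ≤ q → LocalHit q AB →
      (shortWeierstrass AB).HasMultiplicativeReductionAtPrime q := by
    intro q _ hq5 hq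
    exact (hasMultiplicativeReductionAtPrime_shortWeierstrass_iff_of_isInHeightFamily q
      hAB hq5).mpr ⟨((padicValInt_eq_one_iff _).mp hq.2).1, hq.1⟩
  exact ⟨ℓ₁, ℓ₂, i₁, i₂, hne, h5₁, h5₂, by omega, by omega, hmult h5₁ hL₁, hmult h5₂ hL₂, hL₁.2,
    hL₂.2⟩

/-- **The `W`-clause of the `p = 5` class theorems holds for a density-one set of curves**: a
(lower) naive-height density one of pairs `(A, B)` satisfy LITERALLY the binder `hram₂` of
`bsz_h9_five_of_zhang_of_skinnerZhang` — two distinct primes `ℓ₁, ℓ₂ > 5` of multiplicative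
reduction of `E_{A,B}` with `¬ 5 ∣ ord_{ℓᵢ}(4A³ + 27B²)` (indeed `ord = 1`; W. Zhang 2014's
hypothesis (3) via `zhang_hyp3_of_two_ramified`, Skinner–Zhang's (c), and — keeping one prime — the
binder `hram` of `bsz_h5_multiplicative_five_of_thmA`). Lemma 20's second property at `p = 5` AS
PRINTED ("`ℓ ≠ p`").
[cite: BhargavaSkinnerZhang2014, Lemma 20 (second property at p = 5) and Remark 7] -/
theorem heightDensityGE_hram₂_five :
    HeightDensityGE (fun AB : ℤ × ℤ ↦ ∃ ℓ₁ ℓ₂ : ℕ, ∃ _ : Fact ℓ₁.Prime, ∃ _ : Fact ℓ₂.Prime,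
      ℓ₁ ≠ ℓ₂ ∧ 5 < ℓ₁ ∧ 5 < ℓ₂ ∧
      (shortWeierstrass AB).HasMultiplicativeReductionAtPrime ℓ₁ ∧
      (shortWeierstrass AB).HasMultiplicativeReductionAtPrime ℓ₂ ∧
      ¬ 5 ∣ padicValInt ℓ₁ (4 * AB.1 ^ 3 + 27 * AB.2 ^ 2) ∧
      ¬ 5 ∣ padicValInt ℓ₂ (4 * AB.1 ^ 3 + 27 * AB.2 ^ 2)) 1 := by
  intro ε hε
  refine (heightDensityGE_twoMultiplicativePrimes_gt 5 ε hε).mono fun X hX ↦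
    hX.trans (heightProportion_mono ?_ X)
  rintro AB ⟨ℓ₁, ℓ₂, i₁, i₂, hne, -, -, h₁, h₂, hm₁, hm₂, hv₁, hv₂⟩
  exact ⟨ℓ₁, ℓ₂, i₁, i₂, hne, h₁, h₂, hm₁, hm₂, by rw [hv₁]; decide, by rw [hv₂]; decide⟩

/-- **One ramified prime `ℓ ≠ 5` for a density-one set of curves** — LITERALLY the binder `hram` of
`bsz_h5_multiplicative_five_of_thmA` (the rank-`0` multiplicative leg: Skinner–Urban's auxiliary
prime of multiplicative reduction `ℓ ≠ p` at which `E[p]` is ramified, Theorem 5 (c) of the source),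
from `heightDensityGE_hram₂_five` by keeping one of the two primes.
[cite: BhargavaSkinnerZhang2014, Lemma 20 (second property at p = 5), Thm. 5 (c), Remark 7] -/
theorem heightDensityGE_hram_five :
    HeightDensityGE (fun AB : ℤ × ℤ ↦ ∃ ℓ : ℕ, ∃ _ : Fact ℓ.Prime, 5 < ℓ ∧
      (shortWeierstrass AB).HasMultiplicativeReductionAtPrime ℓ ∧
      ¬ 5 ∣ padicValInt ℓ (4 * AB.1 ^ 3 + 27 * AB.2 ^ 2)) 1 := by
  intro ε hε
  refine (heightDensityGE_hram₂_five ε hε).mono fun X hX ↦ hX.trans (heightProportion_mono ?_ X)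
  rintro AB ⟨ℓ₁, -, i₁, -, -, h₁, -, hm₁, -, hv₁, -⟩
  exact ⟨ℓ₁, i₁, h₁, hm₁, hv₁⟩

end Literature.NumberTheory.EllipticCurves

end
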